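import Summits.NavierStokesRegularity.FunctionalMining.StretchingLaminateRecord2
import Summits.NavierStokesRegularity.FunctionalMining.StretchingLaminateRecordConst
import HarnessLib

/-!
# K1-Q1″: the typed record tree `d3g1` bounds `C_lam` unconditionally — `0.6719 ≤ C_lam ≤ 2/√3`

Cell `pub-nsfunc` (host summit NavierStokesRegularity, topic `FunctionalMining`), dictionary seat gen 9.
**Search for candidate a priori estimates; no regularity claim.** STATIC tree arithmetic only: nothing about
Navier–Stokes solutions is asserted anywhere in this file. Successor of (af) `StretchingLaminateRecordConst`
(`0.6395 ≤ C_lam`, tree `treeG7`, 54 splits): the same six-line corollary with the bank's 170-split tree `treeD3G1`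
of (ai) `StretchingLaminateRecord2` (certificate `6719/10000`, checked there by `decide +kernel`) and (ae)
`StretchingLaminateConst` (`𝒯.cert r = true → r ≤ C_lam`, no realization node): **`0.6719 ≤ C_lam ≤ 2/√3` in the
kernel, unconditionally** — whereas `0.6719` bounds the FIELD constant `C⋆` only through the node
`LaminateRealization` (`laminate_d3g1_le_stretchingSupConst`, (ai)). Unconditionally the tree has
`(2+√5)/8 ≤ C⋆ < 2/√3` (`StretchingWrapFinal`, `NoGo/StretchingSupNotSharp`); the VALUE of `C⋆` stays open and no
conjecture about it is recorded. Kept in its own module so that neither (ae) nor (af) depends on the 170-split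
kernel computation. [ours; bookkeeping]
-/

noncomputable section

namespace Summit.NavierStokesRegularity.FunctionalMining

namespace Laminate

/-- **`6719/10000 ≤ C_lam`, unconditionally** (bank tree `treeD3G1`, 170 splits). [ours] -/
theorem d3g1_le_laminateSupConst : (6719 / 10000 : ℝ) ≤ laminateSupConst := by
  have h := le_laminateSupConst_of_cert treeD3G1 (6719 / 10000) treeD3G1_cert
  push_cast at h
  exact h

/-- **The unconditional kernel window for the laminate constant with the typed record tree:
`0.6719 ≤ C_lam ≤ 2/√3`.** [ours] -/
theorem laminateSupConst_window_d3g1 :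
    (6719 / 10000 : ℝ) ≤ laminateSupConst ∧ laminateSupConst ≤ 2 / Real.sqrt 3 :=
  ⟨d3g1_le_laminateSupConst, laminateSupConst_le_holder⟩

/-- The typed record supersedes (af)'s `1279/2000`: `1279/2000 < 6719/10000 ≤ C_lam`. [ours; bookkeeping] -/
theorem record_lt_d3g1 : (1279 / 2000 : ℝ) < 6719 / 10000 := by norm_num

/-- **Reading for K1-Q1‴ with the typed record: if laminates are sharp then `½ ≤ C⋆ ≤ C_lam` and
`0.6719 ≤ C_lam`** — sharpness alone does not order `C⋆` against `0.6719`. [ours; bookkeeping] -/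
theorem window_of_sharp_d3g1 (hs : LaminatesSharp) :
    1 / 2 ≤ stretchingSupConst (d := Fin 3) ∧ stretchingSupConst (d := Fin 3) ≤ laminateSupConst ∧
      (6719 / 10000 : ℝ) ≤ laminateSupConst :=
  ⟨CellularStretching.half_le_stretchingSupConst, stretchingSupConst_le_laminateSupConst_of_sharp hs,
    d3g1_le_laminateSupConst⟩

/-- **Both nodes ⇒ `0.6719 ≤ C⋆ = C_lam < 2/√3`.** [ours; bookkeeping] -/
theorem window_of_nodes_d3g1 (h : LaminateRealization) (hs : LaminatesSharp) :
    (6719 / 10000 : ℝ) ≤ stretchingSupConst (d := Fin 3) ∧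
      laminateSupConst = stretchingSupConst (d := Fin 3) ∧ laminateSupConst < 2 / Real.sqrt 3 :=
  ⟨laminate_d3g1_le_stretchingSupConst h, laminateSupConst_eq_of_sharp h hs,
    laminateDeficit_iff.mp (laminateDeficit_of_realization h)⟩

end Laminate

end Summit.NavierStokesRegularity.FunctionalMining

end
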